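import Summits.QuantumFields.YangMills.Theorems.SwapVirialDeficitSectorLaplaceEndShellLetters
import HarnessLib

/-!
# `stub_end_gaussCore` FROM A POLYNOMIAL RATE, and the shell window of the comparison — N4 of LEAD g99's memo11
# (free-hands support of ⟨stmt-QuantumFields-24197⟩ `SwapVirialDeficit.SwapGluedStiffness`)

The matched comparison `hG♭` of ✓`stub_core_end_of_gaussCore` asks for the constant `1/128`.  What the slab/shell comparison (memo11 §3) naturally proves is a
RATE: `slab ≤ C·L^c·τ^γ·(2π/b)^α·M_ε` (`γ = 1/6` from ✓`lintegral_endSlab_le`) above a polynomial threshold.  This file does the bookkeeping once: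
* §1 ★★ `gaussCore_of_rate` — from `∀ L τ ≤ ½, ∀ b ≥ K₁L^{k₁}τ⁻¹^{k₁}, ∀ good ε: LHS ≤ C·L^c·τ^γ·main` to the registered shape `∃ K k τ₀ …: LHS ≤ (1/128)·main`
  (`K = K₁`, `k = k₁ + ⌈c/γ⌉₊ + 1`, `τ₀ = min ½ ((128C)⁻¹)^{1/γ}`), for ANY family of left sides `LHS L τ b ε ≥ 0`-agnostic (pure real bookkeeping);
* §2 `gaussCore_target_of_shell` — the target may be proved against the SHELL part of the main term in `δ`-letters:
  `κ·(coneConst·π·I) ≤ (1/128)(2π/b)^α·coneConst·π·∫_S((1+δ²)⁻¹)²∫𝔪(hubAt δ 1)` ⟹ `κ·(coneConst·π·I) ≤ (1/128)·((2π/b)^α·M_ε)` (✓`mbMain_ge_of_subset`);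
* §3 the shell window: `endSlab_abs_le` (`|δ| ≤ (2/3)√τ` on the end window), `Icc_subset_endShell` (`[r/2, r] ⊆ {τ ≤ 4δ²/(1+δ²)², |δ| ≤ r}` for `τ ≤ r²/4`,
  `0 < r ≤ 1`), `endShell_weight_ge` (`r/8 ≤ ∫_{[r/2,r]} ((1+δ²)⁻¹)²`).

HONEST LABEL: bookkeeping; `stub_end_gaussCore`, stubs core-tip ∕ 001-good of ➎, ⟨24197⟩ ∕ ⟨24194⟩ OPEN; own crux ⟨22884⟩ `LargeFieldMassRefinementTail` OPEN
(blocked-on ⟨19935⟩); the Yang–Mills mass gap is NOT proved; no summit is proved by a line.  THEOREMS ONLY (0 `def`, 0 `sorry`), standard axioms; the series'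
local `ℍ` instances.  LEAD seat ym-line-sfw-p2 g99 (cell ym-idea-1, free hands), `--supports stmt-QuantumFields-24197`.  References: [folklore].
-/

set_option autoImplicit false
set_option synthInstance.maxSize 1024

noncomputable section

open MeasureTheory Quaternion Set
open scoped Quaternion BigOperators ENNReal
open Literature.MathematicalPhysics.QuantumLattice
open Literature.MathematicalPhysics.QuantumFieldTheory hiding SU2
open Summit.QuantumFields.YangMills.Theorems.SwapTwistDeficit.ToronLog

attribute [local instance] Literature.Analysis.FluidPDE.Tao2016.quatMeasurableSpace
  Literature.Analysis.FluidPDE.Tao2016.quatBorelSpace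
  Literature.MathematicalPhysics.QuantumLattice.secondCountableTopology_su2

namespace Summit.QuantumFields.YangMills.Theorems.SwapVirialDeficit.SectorLaplace

open Summit.QuantumFields.YangMills.Theorems.FemtoTransferGap
open Summit.QuantumFields.YangMills.Theorems.FemtoTransferGap.TT
open Summit.QuantumFields.YangMills.Theorems.VirialFluxGap.RingDeficit
open Summit.QuantumFields.YangMills.Theorems.SwapVirialDeficit.SwapRing
open Summit.QuantumFields.YangMills.Theorems.SwapVirialDeficit.BlowUpRing

/-! ## §1 From a polynomial rate to the constant `1/128` -/

/-- ★★ **FROM A RATE TO THE REGISTERED SHAPE** (pure bookkeeping, for ANY left sides `lhs` and main terms `main ≥ 0`): if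
`lhs L τ b ε ≤ C·L^c·τ^γ·main L τ b ε` for all `L`, `0 < τ ≤ ½`, `b ≥ K₁·L^{k₁}·τ⁻¹^{k₁}` and good `ε` (`C > 0`, `γ > 0`), then with `k = k₁ + ⌈c/γ⌉₊ + 1` and
`τ₀ = min ½ ((128C)⁻¹)^{1/γ}`: `lhs ≤ (1/128)·main` for all `τ ≤ τ₀/L^k`, `b ≥ K₁·L^k·τ⁻¹^k`. [folklore] -/
theorem gaussCore_of_rate (lhs main : ∀ L : ℕ, ℝ → ℝ → GnoSign L → ℝ) (hmain : ∀ (L : ℕ) (τ b : ℝ) (ε : GnoSign L), 0 ≤ main L τ b ε)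
    {C γ K₁ : ℝ} {c k₁ : ℕ} (hC : 0 < C) (hγ : 0 < γ) (hK₁ : 0 < K₁)
    (hrate : ∀ (L : ℕ) [NeZero L] (τ : ℝ), 0 < τ → τ ≤ 1 / 2 → ∀ b : ℝ, K₁ * (L : ℝ) ^ k₁ * τ⁻¹ ^ k₁ ≤ b → ∀ ε : GnoSign L, GoodSign ε →
      lhs L τ b ε ≤ C * (L : ℝ) ^ c * τ ^ γ * main L τ b ε) :
    ∃ K : ℝ, 0 < K ∧ ∃ k : ℕ, ∃ τ₀ : ℝ, 0 < τ₀ ∧ τ₀ ≤ 1 / 2 ∧ ∀ (L : ℕ) [NeZero L] (τ : ℝ), 0 < τ → τ ≤ τ₀ / (L : ℝ) ^ k →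
      ∀ b : ℝ, K * (L : ℝ) ^ k * τ⁻¹ ^ k ≤ b → ∀ ε : GnoSign L, GoodSign ε → lhs L τ b ε ≤ (1 / 128 : ℝ) * main L τ b ε := by
  set N : ℕ := ⌈(c : ℝ) / γ⌉₊ + 1 with hN
  set τ₁ : ℝ := ((128 * C)⁻¹) ^ (1 / γ) with hτ₁
  have hτ₁0 : 0 < τ₁ := Real.rpow_pos_of_pos (by positivity) _
  refine ⟨K₁, hK₁, k₁ + N, min (1 / 2) τ₁, lt_min (by norm_num) hτ₁0, min_le_left _ _, fun L _ τ hτ hτle b hb ε hε => ?_⟩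
  have hL1 : (1 : ℝ) ≤ L := by exact_mod_cast NeZero.one_le
  have hL0 : (0 : ℝ) < L := by linarith
  have hLk : (1 : ℝ) ≤ (L : ℝ) ^ (k₁ + N) := one_le_pow₀ hL1
  have hτ0le : min (1 / 2) τ₁ / (L : ℝ) ^ (k₁ + N) ≤ min (1 / 2) τ₁ := div_le_self (lt_min (by norm_num) hτ₁0).le hLk
  have hτ1 : τ ≤ 1 / 2 := hτle.trans (hτ0le.trans (min_le_left _ _))
  have hτi1 : 1 ≤ τ⁻¹ := by rw [one_le_inv₀ hτ]; linarith
  -- the threshold at `k₁`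
  have hb₁ : K₁ * (L : ℝ) ^ k₁ * τ⁻¹ ^ k₁ ≤ b := by
    refine le_trans ?_ hb
    exact mul_le_mul (mul_le_mul_of_nonneg_left (pow_le_pow_right₀ hL1 (Nat.le_add_right _ _)) hK₁.le)
      (pow_le_pow_right₀ hτi1 (Nat.le_add_right _ _)) (by positivity) (by positivity)
  have h := hrate L τ hτ hτ1 b hb₁ ε hε
  refine h.trans (mul_le_mul_of_nonneg_right ?_ (hmain L τ b ε))
  -- `C·L^c·τ^γ ≤ 1/128`
  have hτγ : τ ^ γ ≤ (τ₁ / (L : ℝ) ^ (k₁ + N)) ^ γ :=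
    Real.rpow_le_rpow hτ.le (hτle.trans (div_le_div_of_nonneg_right (min_le_right _ _) (by positivity))) hγ.le
  have hsplit : (τ₁ / (L : ℝ) ^ (k₁ + N)) ^ γ = τ₁ ^ γ / ((L : ℝ) ^ (k₁ + N)) ^ γ := Real.div_rpow hτ₁0.le (by positivity) γ
  have hτ₁γ : τ₁ ^ γ = (128 * C)⁻¹ := by
    rw [hτ₁, ← Real.rpow_mul (by positivity), one_div_mul_cancel hγ.ne', Real.rpow_one]
  -- `L^c ≤ (L^(k₁+N))^γ`
  have hcN : (c : ℝ) ≤ ((k₁ + N : ℕ) : ℝ) * γ := by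
    have h1 : (c : ℝ) / γ ≤ ⌈(c : ℝ) / γ⌉₊ := Nat.le_ceil _
    have h2 : (⌈(c : ℝ) / γ⌉₊ : ℝ) + 1 ≤ ((k₁ + N : ℕ) : ℝ) := by
      rw [hN]; push_cast; linarith [(Nat.cast_nonneg k₁ : (0 : ℝ) ≤ k₁)]
    rw [div_le_iff₀ hγ] at h1
    nlinarith
  have hLpow : (L : ℝ) ^ c ≤ ((L : ℝ) ^ (k₁ + N)) ^ γ := by
    rw [← Real.rpow_natCast (L : ℝ) c, ← Real.rpow_natCast (L : ℝ) (k₁ + N), ← Real.rpow_mul hL0.le]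
    exact Real.rpow_le_rpow_of_exponent_le hL1 hcN
  have hLγ0 : 0 < ((L : ℝ) ^ (k₁ + N)) ^ γ := Real.rpow_pos_of_pos (by positivity) _
  calc C * (L : ℝ) ^ c * τ ^ γ ≤ C * (L : ℝ) ^ c * (τ₁ ^ γ / ((L : ℝ) ^ (k₁ + N)) ^ γ) := by
        rw [← hsplit]; exact mul_le_mul_of_nonneg_left hτγ (by positivity)
    _ = C * τ₁ ^ γ * ((L : ℝ) ^ c / ((L : ℝ) ^ (k₁ + N)) ^ γ) := by ring
    _ ≤ C * τ₁ ^ γ * 1 := by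
        refine mul_le_mul_of_nonneg_left ((div_le_one hLγ0).2 hLpow) ?_
        rw [hτ₁γ]; positivity
    _ = 1 / 128 := by rw [hτ₁γ]; field_simp

/-! ## §2 The target against the shell part of the main term -/

variable {L : ℕ} [NeZero L]

/-- **THE TARGET MAY BE PROVED AGAINST THE SHELL**: for good `ε`, `0 < τ ≤ 1`, a measurable-agnostic `S` inside the bulk window and any `I`, `κ`, `b`:
if `κ·(coneConst·π·I) ≤ (1/128)·(2π/b)^α·(coneConst·π·∫_S ((1+δ²)⁻¹)²·∫𝔪(hubAt δ 1, ε, ·))` then `κ·(coneConst·π·I) ≤ (1/128)·((2π/b)^α·M_ε)`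
(✓`mbMain_ge_of_subset`; `(2π/b)^α ≥ 0` needs `0 ≤ b`). [folklore] -/
theorem gaussCore_target_of_shell {ε : GnoSign L} (hε : GoodSign ε) {τ : ℝ} (hτ : 0 < τ) (hτ1 : τ ≤ 1) {S : Set ℝ}
    (hS : S ⊆ {δ : ℝ | τ ≤ 4 * δ ^ 2 / (1 + δ ^ 2) ^ 2 ∧ τ ≤ (1 + δ ^ 2)⁻¹}) {κ I b : ℝ} (hb : 0 ≤ b)
    (h : κ * (coneConst * Real.pi * I) ≤ (1 / 128 : ℝ) * ((2 * Real.pi / b) ^ alpha L *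
      (coneConst * Real.pi * ∫ δ in S, ((1 + δ ^ 2)⁻¹) ^ 2 * ∫ p : ℝ × ℝ, mbDensity (L := L) (hubAt δ 1) ε p))) :
    κ * (coneConst * Real.pi * I) ≤ (1 / 128 : ℝ) * ((2 * Real.pi / b) ^ alpha L * ∫ a in HubBulk τ, (∫ p : ℝ × ℝ, mbDensity (L := L) a ε p) ∂coneMeasure) := by
  have hsh := mbMain_ge_of_subset (L := L) hε hτ hτ1 hS
  have hq : 0 ≤ (2 * Real.pi / b) ^ alpha L := Real.rpow_nonneg (div_nonneg (by positivity) hb) _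
  exact h.trans (mul_le_mul_of_nonneg_left (mul_le_mul_of_nonneg_left hsh hq) (by norm_num))

/-! ## §3 The shell window -/

omit [NeZero L] in
/-- On the end window: `|δ| ≤ (2/3)·√τ` (✓`endWindow_sq_le`). [folklore] -/
theorem endSlab_abs_le {δ τ : ℝ} (h1 : 4 * δ ^ 2 / (1 + δ ^ 2) ^ 2 < τ) (h2 : τ ≤ (1 + δ ^ 2)⁻¹) : |δ| ≤ 2 / 3 * Real.sqrt τ := by
  have h := endWindow_sq_le h1 h2
  have hτ : 0 ≤ τ := le_trans (by positivity) h1.le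
  have e : 2 / 3 * Real.sqrt τ = Real.sqrt (4 * τ / 9) := by
    rw [show 4 * τ / 9 = (2 / 3) ^ 2 * τ by ring, Real.sqrt_mul' _ hτ, Real.sqrt_sq (by norm_num)]
  rw [e, ← Real.sqrt_sq_eq_abs]
  exact Real.sqrt_le_sqrt h

omit [NeZero L] in
/-- `[r/2, r] ⊆ {τ ≤ 4δ²/(1+δ²)², |δ| ≤ r}` for `0 < r ≤ 1` and `τ ≤ r²/4` (`4δ²/(1+δ²)² ≥ δ² ≥ r²/4` for `δ² ≤ 1`). [folklore] -/
theorem Icc_subset_endShell {τ r : ℝ} (hr0 : 0 < r) (hr1 : r ≤ 1) (hτ : τ ≤ r ^ 2 / 4) :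
    Icc (r / 2) r ⊆ {δ : ℝ | τ ≤ 4 * δ ^ 2 / (1 + δ ^ 2) ^ 2 ∧ |δ| ≤ r} := by
  intro δ hδ
  have hδ0 : 0 ≤ δ := by linarith [hδ.1]
  refine ⟨?_, abs_le.2 ⟨by linarith [hδ.1], hδ.2⟩⟩
  have hδ1 : δ ^ 2 ≤ 1 := by nlinarith [hδ.2]
  rw [le_div_iff₀ (by positivity)]
  have h4 : (1 + δ ^ 2) ^ 2 ≤ 4 := by nlinarith
  have hr2 : r ^ 2 / 4 ≤ δ ^ 2 := by nlinarith [hδ.1]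
  calc τ * (1 + δ ^ 2) ^ 2 ≤ r ^ 2 / 4 * 4 := mul_le_mul (hτ) h4 (by positivity) (by positivity)
    _ = r ^ 2 := by ring
    _ ≤ 4 * δ ^ 2 := by nlinarith

omit [NeZero L] in
/-- The shell weight: `r/8 ≤ ∫_{[r/2, r]} ((1+δ²)⁻¹)² dδ` for `0 ≤ r ≤ 1` (the weight is `≥ ¼` on `|δ| ≤ 1`). [folklore] -/
theorem endShell_weight_ge {r : ℝ} (hr0 : 0 ≤ r) (hr1 : r ≤ 1) : r / 8 ≤ ∫ δ in Icc (r / 2) r, ((1 + δ ^ 2)⁻¹) ^ 2 := by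
  have hle : ∀ δ ∈ Icc (r / 2) r, (1 / 4 : ℝ) ≤ ((1 + δ ^ 2)⁻¹) ^ 2 := by
    intro δ hδ
    have hδ1 : δ ^ 2 ≤ 1 := by have := hδ.1; have := hδ.2; nlinarith
    have h2 : (1 / 2 : ℝ) ≤ (1 + δ ^ 2)⁻¹ := by
      rw [le_inv_comm₀ (by norm_num) (by positivity)]; norm_num; linarith
    nlinarith
  have hc1 : Continuous fun δ : ℝ => 1 + δ ^ 2 := by fun_prop
  have hcont : Continuous fun δ : ℝ => ((1 + δ ^ 2)⁻¹) ^ 2 :=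
    (hc1.inv₀ fun δ => (by positivity : (0 : ℝ) < 1 + δ ^ 2).ne').pow 2
  have hint : IntegrableOn (fun δ : ℝ => ((1 + δ ^ 2)⁻¹) ^ 2) (Icc (r / 2) r) := hcont.integrableOn_Icc
  have h := setIntegral_mono_on (integrableOn_const (by simp)) hint measurableSet_Icc hle
  have hvol : ∫ _ in Icc (r / 2) r, (1 / 4 : ℝ) = (1 / 4) * (r - r / 2) := by
    rw [setIntegral_const, Real.volume_real_Icc_of_le (by linarith), smul_eq_mul, mul_comm]
  rw [hvol] at h
  linarith

/-! ## §4 The rate on a polynomial window of cuts (appended, LEAD g99 23:05Z) -/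

/-- ★★ **FROM A RATE ON A WINDOW TO THE REGISTERED SHAPE**: as ✓`gaussCore_of_rate`, but the rate `lhs ≤ C·L^c·τ^γ·main` is only required for cuts in a polynomial
window `τ ≤ τw/L^{kw}` (`0 < τw`) — the form the slab∕shell comparison delivers (it needs `√τ ≪ r_m(L)`).  Conclusion: the registered shape with
`τ₀ ≤ τw`, `k ≥ kw`. [folklore] -/
theorem gaussCore_of_rate_window (lhs main : ∀ L : ℕ, ℝ → ℝ → GnoSign L → ℝ) (hmain : ∀ (L : ℕ) (τ b : ℝ) (ε : GnoSign L), 0 ≤ main L τ b ε)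
    {C γ K₁ τw : ℝ} {c k₁ kw : ℕ} (hC : 0 < C) (hγ : 0 < γ) (hK₁ : 0 < K₁) (hτw : 0 < τw)
    (hrate : ∀ (L : ℕ) [NeZero L] (τ : ℝ), 0 < τ → τ ≤ τw / (L : ℝ) ^ kw → ∀ b : ℝ, K₁ * (L : ℝ) ^ k₁ * τ⁻¹ ^ k₁ ≤ b → ∀ ε : GnoSign L, GoodSign ε →
      lhs L τ b ε ≤ C * (L : ℝ) ^ c * τ ^ γ * main L τ b ε) :
    ∃ K : ℝ, 0 < K ∧ ∃ k : ℕ, ∃ τ₀ : ℝ, 0 < τ₀ ∧ τ₀ ≤ 1 / 2 ∧ ∀ (L : ℕ) [NeZero L] (τ : ℝ), 0 < τ → τ ≤ τ₀ / (L : ℝ) ^ k →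
      ∀ b : ℝ, K * (L : ℝ) ^ k * τ⁻¹ ^ k ≤ b → ∀ ε : GnoSign L, GoodSign ε → lhs L τ b ε ≤ (1 / 128 : ℝ) * main L τ b ε := by
  classical
  -- the windowed left side: `lhs` inside the window, `0` outside
  set lhs' : ∀ L : ℕ, ℝ → ℝ → GnoSign L → ℝ := fun L τ b ε => if τ ≤ τw / (L : ℝ) ^ kw then lhs L τ b ε else 0 with hlhs'
  have hrate' : ∀ (L : ℕ) [NeZero L] (τ : ℝ), 0 < τ → τ ≤ 1 / 2 → ∀ b : ℝ, K₁ * (L : ℝ) ^ k₁ * τ⁻¹ ^ k₁ ≤ b → ∀ ε : GnoSign L, GoodSign ε →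
      lhs' L τ b ε ≤ C * (L : ℝ) ^ c * τ ^ γ * main L τ b ε := by
    intro L _ τ hτ hτ2 b hb ε hε
    by_cases hw : τ ≤ τw / (L : ℝ) ^ kw
    · have e : lhs' L τ b ε = lhs L τ b ε := by rw [hlhs']; exact if_pos hw
      rw [e]; exact hrate L τ hτ hw b hb ε hε
    · have e : lhs' L τ b ε = 0 := by rw [hlhs']; exact if_neg hw
      rw [e]
      have : 0 ≤ τ ^ γ := Real.rpow_nonneg hτ.le _
      exact mul_nonneg (by positivity) (hmain L τ b ε)
  obtain ⟨K, hK, k, τ₀, hτ₀, hτ₀2, h⟩ := gaussCore_of_rate lhs' main hmain hC hγ hK₁ hrate'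
  refine ⟨K, hK, k + kw, min τ₀ τw, lt_min hτ₀ hτw, (min_le_left _ _).trans hτ₀2, fun L _ τ hτ hτle b hb ε hε => ?_⟩
  have hL1 : (1 : ℝ) ≤ L := by exact_mod_cast NeZero.one_le
  have hτi1 : 1 ≤ τ⁻¹ := by
    rw [one_le_inv₀ hτ]
    have hLk : (1 : ℝ) ≤ (L : ℝ) ^ (k + kw) := one_le_pow₀ hL1
    exact hτle.trans ((div_le_self (lt_min hτ₀ hτw).le hLk).trans ((min_le_left _ _).trans (hτ₀2.trans (by norm_num))))
  -- inside the window
  have hw : τ ≤ τw / (L : ℝ) ^ kw :=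
    hτle.trans (div_le_div₀ hτw.le (min_le_right _ _) (by positivity) (pow_le_pow_right₀ hL1 (Nat.le_add_left _ _)))
  have hτ₀' : τ ≤ τ₀ / (L : ℝ) ^ k :=
    hτle.trans (div_le_div₀ hτ₀.le (min_le_left _ _) (by positivity) (pow_le_pow_right₀ hL1 (Nat.le_add_right _ _)))
  have hb' : K * (L : ℝ) ^ k * τ⁻¹ ^ k ≤ b := by
    refine le_trans ?_ hb
    exact mul_le_mul (mul_le_mul_of_nonneg_left (pow_le_pow_right₀ hL1 (Nat.le_add_right _ _)) hK.le)
      (pow_le_pow_right₀ hτi1 (Nat.le_add_right _ _)) (by positivity) (by positivity)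
  have hmain' := h L τ hτ hτ₀' b hb' ε hε
  have e : lhs' L τ b ε = lhs L τ b ε := by rw [hlhs']; exact if_pos hw
  rw [e] at hmain'
  exact hmain'

end Summit.QuantumFields.YangMills.Theorems.SwapVirialDeficit.SectorLaplace

end
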